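import Summits.BirchSwinnertonDyer.BirchSwinnertonDyer.Theorems.SignedLowerHalvesSmallImageLowerHalfBothSignsRttCharRoadCoeffLattice
import Summits.BirchSwinnertonDyer.BirchSwinnertonDyer.Theorems.SignedLowerHalvesSmallImageLowerHalfBothSignsRttCharRoadCurveSide
import Summits.BirchSwinnertonDyer.BirchSwinnertonDyer.Theorems.ResidualThetaTransportAtTwoResidualSignedLambdaLowerCMAtTwoAwayExhaustion
import Literature.NumberTheory.EllipticCurves.Kato2004.IwasawaH1CoeffRingLemmasProofs
import Literature.NumberTheory.EllipticCurves.HasseWeilAbelianLSeriesProofs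
import Literature.NumberTheory.EllipticCurves.GreenbergSelmerNewform
import Literature.NumberTheory.GaloisRepresentations.GaloisRep
import Literature.NumberTheory.GaloisRepresentations.LubinTateCharacterLimit
import Mathlib.RingTheory.Localization.Module
import Mathlib.LinearAlgebra.FreeModule.IdealQuotient
import HarnessLib

/-!
# Route `SignedLowerHalves`, crux L `SmallImageLowerHalfBothSigns` (stmt-BirchSwinnertonDyer-23599), line `rtt_w3` v12 — row T-2 / J-loc′ of INJ_top:
# SMITH-ADAPTED COORDINATES ON `(F_S/𝒪_S)(θ)`: `f/2` of them are already jointly injective on the `π`-torsion, and `p^{2·#J} = #(𝒪_S/π)`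

Hand `bsd-inputs-honda-p1` g20 (LEAD `cruxlead-stmt-BirchSwinnertonDyer-23599` g7, INPUT SPEC (I6) `hsinj` / (I7) `hJ`); helper `--supports stmt-BirchSwinnertonDyer-23599`;
THEOREMS ONLY (no definition, no named fact, no instance, no `sorry`).  BSD / crux L / INJ_top / T-2 are NOT proved here.

Refinement of `…RttCharRoadCoordinates.exists_cofree_coordinates`: choose the `𝒪_v`-basis of `𝒪_S` ADAPTED to the ideal `(π)` (`π` the stub's
irreducible of `𝒪_S`) by Mathlib's Smith normal form for ideals (`Ideal.ringBasis` / `Ideal.selfBasis` / `Ideal.smithCoeffs`): `𝒪_S` has a basis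
`rb` and `(π)` the basis `a_i · rb_i`; the basis `y_i := π⁻¹ a_i rb_i` of `𝒪_S` has the property that the `y`-coordinates of `π⁻¹𝒪_S` are
`a_i⁻¹ 𝒪_v`, so the coordinates modulo `𝒪_v` VANISH on `M[π]` at every index with `a_i` a unit.  ★★★ `exists_cofree_coordinates_adapted`:
`𝒪_v`-linear, jointly injective coordinates `c_i : Cofree θ F_S → K_v ⧸ 𝒪_v·1` and a finset `J` (the non-unit Smith coefficients) with
`π • m = 0 → (∀ i ∈ J, c_i m = 0) → m = 0` (the LEAD's `hsinj` on `Sπ = M[π]` for the sub-family `J`) and `p ^ (2 · #J) = #(𝒪_S ⧸ (π))`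
(each non-unit `a_i` is associated to `p`, as `p ∈ (π)`; `#(𝒪_v/p) = p²` at the inert `v`) — the count (I7) with EQUALITY.

References: [NeukirchANT1999] Ch. II (6.8); [SerreLocalFields1979] Ch. I §4, Ch. II §2 Prop. 3; [Bourbaki, Algèbre VII §4 no. 3 (invariant factors)].
-/

set_option autoImplicit false
-- D-0017: single-problem summit, the namespace repeats the problem name by design.
set_option linter.dupNamespace false
noncomputable section

open scoped Classical NumberField nonZeroDivisors
open NumberField IsDedekindDomain IsDedekindDomain.HeightOneSpectrum Field ValuativeRel
  Literature.NumberTheory.EllipticCurves Literature.NumberTheory.EllipticCurves.GreenbergSelmer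
  Literature.NumberTheory.GaloisRepresentations Literature.NumberTheory.NumberFields
  Literature.NumberTheory.GaloisRepresentations.IsNonarchimedeanLocalField

namespace Summit.BirchSwinnertonDyer.BirchSwinnertonDyer.Theorems.SmallImageRttCharRoad

section Adapted

variable {K : Type} [Field K] [NumberField K] (v : HeightOneSpectrum (𝓞 K)) {p : ℕ} [hp : Fact p.Prime] {S : Set (PadicAlgCl p)}
  (θ : FramedGaloisRep K (padicCoeffIntegers S) 1) (ι : v.adicCompletionIntegers K →+* padicCoeffIntegers S)

/-- **`(p) = 𝔪` in `𝒪_v` at the inert place `v = (p)`**: `p` is irreducible in `𝒪_v = v.adicCompletionIntegers K` and generates the maximal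
ideal (the tree's `isUniformizer_neg_natCast_of_asIdeal_eq_span` read through `integerEquivAdicCompletionIntegers`). [cite: NeukirchANT1999, Ch. II §5] -/
theorem maximalIdeal_adicCompletionIntegers_eq_span_natCast (hv : v.asIdeal = Ideal.span {((p : ℕ) : 𝓞 K)}) :
    IsLocalRing.maximalIdeal (v.adicCompletionIntegers K) = Ideal.span {((p : ℕ) : v.adicCompletionIntegers K)} := by
  have hπ := (isUniformizer_neg_natCast_of_asIdeal_eq_span v hv).2
  have hmax := maximalIdeal_eq_span_singleton hπ
  have hirr : Irreducible ((p : ℕ) : 𝒪[v.adicCompletion K]) :=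
    IsDiscreteValuationRing.irreducible_of_span_eq_maximalIdeal _ (fun h ↦ hπ.ne_zero (by rw [h]; rfl)) hmax
  have hirr' : Irreducible ((p : ℕ) : v.adicCompletionIntegers K) := by
    have h := (MulEquiv.irreducible_iff (integerEquivAdicCompletionIntegers v)).mpr hirr
    rwa [map_natCast] at h
  exact hirr'.maximalIdeal_eq

omit hp in
/-- `#(𝒪_v/𝔪) = p²` at the inert place of a quadratic field. [cite: NeukirchANT1999, Ch. I §8] -/
theorem natCard_residueField_adicCompletionIntegers_eq_sq (hK2 : Module.finrank ℚ K = 2) (hv : v.asIdeal = Ideal.span {((p : ℕ) : 𝓞 K)}) :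
    Nat.card (IsLocalRing.ResidueField (v.adicCompletionIntegers K)) = p ^ 2 := by
  rw [natCard_residueField_adicCompletionIntegers_eq_absNorm, hv, Ideal.absNorm_span_singleton,
    show ((p : ℕ) : 𝓞 K) = algebraMap ℤ (𝓞 K) (p : ℤ) by simp, Algebra.norm_algebraMap, NumberField.RingOfIntegers.rank, hK2,
    Int.natAbs_pow, Int.natAbs_natCast]

-- the `π • [x] = [π • x]` identification on the cofree quotient needs a deep instance unfolding (one `isDefEq`)
set_option maxHeartbeats 400000 in
include hp in
/-- ★★★ **Smith-adapted `𝒪_v`-linear coordinates on `(F_S/𝒪_S)(θ)`**: jointly injective, with a finset `J` of indices — those whose Smith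
coefficient of `(π) ⊆ 𝒪_S` is not a unit — such that the `J`-coordinates are already jointly injective on the `π`-torsion, and
`p ^ (2 · #J) = #(𝒪_S ⧸ (π))`. [cite: NeukirchANT1999, Ch. II (6.8)] [cite: SerreLocalFields1979, Ch. I §4] -/
theorem exists_cofree_coordinates_adapted [FiniteDimensional ℚ_[p] (padicCoeffField S)] (hpv : ((p : ℕ) : 𝓞 K) ∈ v.asIdeal)
    (hK2 : Module.finrank ℚ K = 2) (hv : v.asIdeal = Ideal.span {((p : ℕ) : 𝓞 K)}) {π : padicCoeffIntegers S} (hπ : Irreducible π) :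
    ∃ (d : ℕ) (c : Fin d → (Cofree θ (padicCoeffField S) →+
        (v.adicCompletion K ⧸ Submodule.span (v.adicCompletionIntegers K) {(1 : v.adicCompletion K)}))) (J : Finset (Fin d)),
      (∀ (i : Fin d) (b : v.adicCompletionIntegers K) (m : Cofree θ (padicCoeffField S)), c i (ι b • m) = b • c i m) ∧
      (∀ m : Cofree θ (padicCoeffField S), (∀ i, c i m = 0) → m = 0) ∧
      (∀ m : Cofree θ (padicCoeffField S), π • m = 0 → (∀ i ∈ J, c i m = 0) → m = 0) ∧
      p ^ (2 * J.card) = Nat.card (padicCoeffIntegers S ⧸ Ideal.span {π}) := by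
  -- notation
  haveI : CharZero (v.adicCompletion K) := LocalField.charZero_adicCompletion v
  letI algO : Algebra (v.adicCompletionIntegers K) (padicCoeffIntegers S) := ι.toAlgebra
  haveI : Module.Finite (v.adicCompletionIntegers K) (padicCoeffIntegers S) := moduleFinite_of_coeffRingHom v ι hpv
  haveI : Module.Free (v.adicCompletionIntegers K) (padicCoeffIntegers S) := moduleFree_of_coeffRingHom v ι hpv
  -- the DVR `𝒪_S`, its ideal `(π) ∋ p`
  haveI : IsDiscreteValuationRing (padicCoeffIntegers S) := Kato2004.IwasawaH1CoeffTorsionFree.isDiscreteValuationRing_padicCoeffIntegers S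
  have hI : Ideal.span ({π} : Set (padicCoeffIntegers S)) ≠ ⊥ := by
    rw [ne_eq, Ideal.span_singleton_eq_bot]; exact hπ.ne_zero
  have hpI : ((p : ℕ) : padicCoeffIntegers S) ∈ Ideal.span ({π} : Set (padicCoeffIntegers S)) := by
    rw [← hπ.maximalIdeal_eq]; exact Kato2004.IwasawaH1CoeffExists.natCast_mem_maximalIdeal_padicCoeffIntegers p S
  -- an `𝒪_v`-basis of `𝒪_S` adapted to `(π)` (Smith normal form): `π * y i = a i • rb i`
  obtain ⟨d, ⟨b₀⟩⟩ : ∃ d : ℕ, Nonempty (Module.Basis (Fin d) (v.adicCompletionIntegers K) (padicCoeffIntegers S)) :=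
    ⟨_, ⟨Module.finBasis (v.adicCompletionIntegers K) (padicCoeffIntegers S)⟩⟩
  have hsb := Ideal.selfBasis_def b₀ (Ideal.span ({π} : Set (padicCoeffIntegers S))) hI
  have hane := Ideal.smithCoeffs_ne_zero b₀ (Ideal.span ({π} : Set (padicCoeffIntegers S))) hI
  generalize ha : Ideal.smithCoeffs b₀ (Ideal.span ({π} : Set (padicCoeffIntegers S))) hI = a at hsb hane
  generalize hrb : Ideal.ringBasis b₀ (Ideal.span ({π} : Set (padicCoeffIntegers S))) hI = rb at hsb
  generalize hsb' : Ideal.selfBasis b₀ (Ideal.span ({π} : Set (padicCoeffIntegers S))) hI = sb at hsb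
  -- an adapted basis `b` of `𝒪_S`: `π * b i = a i • rb i` (transport of `selfBasis` along `𝒪_S ≃ (π)`, `z ↦ π z`)
  have hπ0 : π ≠ 0 := hπ.ne_zero
  obtain ⟨b, hb⟩ : ∃ b : Module.Basis (Fin d) (v.adicCompletionIntegers K) (padicCoeffIntegers S), ∀ i, π * b i = a i • rb i := by
    let mulπ : padicCoeffIntegers S →ₗ[v.adicCompletionIntegers K] Ideal.span ({π} : Set (padicCoeffIntegers S)) :=
      { toFun := fun z ↦ ⟨π * z, Ideal.mul_mem_right z _ (Ideal.subset_span rfl)⟩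
        map_add' := fun z₁ z₂ ↦ Subtype.ext (mul_add π z₁ z₂)
        map_smul' := fun r z ↦ Subtype.ext (by
          change π * (r • z) = r • (π * z)
          rw [Algebra.smul_def, Algebra.smul_def, mul_left_comm]) }
    have hmulπ : Function.Bijective mulπ := by
      refine ⟨fun z₁ z₂ h ↦ mul_left_cancel₀ hπ0 (congrArg Subtype.val h), fun w ↦ ?_⟩
      obtain ⟨z, hz⟩ := Ideal.mem_span_singleton'.mp w.2
      exact ⟨z, Subtype.ext (by change π * z = w; rw [mul_comm, hz])⟩
    let eπ := LinearEquiv.ofBijective mulπ hmulπ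
    refine ⟨sb.map eπ.symm, fun i ↦ ?_⟩
    have h1 : mulπ (sb.map eπ.symm i) = sb i := by
      rw [Module.Basis.map_apply]
      exact eπ.apply_symm_apply (sb i)
    exact (congrArg Subtype.val h1).trans (hsb i)
  -- `K_v → F_S` extending `ι`
  have hinjOL : Function.Injective (algebraMap (padicCoeffIntegers S) (padicCoeffField S)) := fun x y h ↦
    Subtype.ext (congrArg (fun z : padicCoeffField S ↦ (z : PadicAlgCl p)) h)
  set g : v.adicCompletionIntegers K →+* padicCoeffField S := (algebraMap (padicCoeffIntegers S) (padicCoeffField S)).comp ι with hgdef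
  have hg : Function.Injective g := hinjOL.comp (injective_coeffRingHom v ι hpv)
  let φ : v.adicCompletion K →+* padicCoeffField S := IsFractionRing.lift hg
  letI algF : Algebra (v.adicCompletion K) (padicCoeffField S) := φ.toAlgebra
  letI algO' : Algebra (v.adicCompletionIntegers K) (padicCoeffField S) := g.toAlgebra
  haveI : IsScalarTower (v.adicCompletionIntegers K) (v.adicCompletion K) (padicCoeffField S) :=
    IsScalarTower.of_algebraMap_eq fun x ↦ (IsFractionRing.lift_algebraMap hg x).symm
  haveI : IsScalarTower (v.adicCompletionIntegers K) (padicCoeffIntegers S) (padicCoeffField S) :=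
    IsScalarTower.of_algebraMap_eq fun _ ↦ rfl
  -- the `𝒪_v`-linear inclusion `𝒪_S → F_S` and `F_S = 𝒪_S[1/p]`
  let f : padicCoeffIntegers S →ₗ[v.adicCompletionIntegers K] padicCoeffField S :=
    (IsScalarTower.toAlgHom (v.adicCompletionIntegers K) (padicCoeffIntegers S) (padicCoeffField S)).toLinearMap
  have hf : ∀ y, f y = algebraMap (padicCoeffIntegers S) (padicCoeffField S) y := fun _ ↦ rfl
  have hp0 : ((p : ℕ) : v.adicCompletionIntegers K) ≠ 0 := fun h ↦ by
    have h' := congrArg (fun z : v.adicCompletionIntegers K ↦ (z : v.adicCompletion K)) h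
    push_cast at h'
    exact (Nat.cast_ne_zero.mpr hp.out.ne_zero) h'
  haveI : IsLocalizedModule (v.adicCompletionIntegers K)⁰ f := by
    refine ⟨fun c ↦ ?_, fun y ↦ ?_, fun {x₁ x₂} h ↦ ⟨1, by rw [hinjOL h]⟩⟩
    · have hc : algebraMap (v.adicCompletionIntegers K) (padicCoeffField S) (c : v.adicCompletionIntegers K) ≠ 0 := by
        intro h0
        exact nonZeroDivisors.ne_zero c.2 (hg (by rw [map_zero]; exact h0))
      rw [Module.End.isUnit_iff]
      refine Function.bijective_iff_has_inverse.mpr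
        ⟨fun m ↦ (algebraMap (v.adicCompletionIntegers K) (padicCoeffField S) (c : v.adicCompletionIntegers K))⁻¹ * m,
          fun m ↦ ?_, fun m ↦ ?_⟩
      · simp only [Module.algebraMap_end_apply, Algebra.smul_def]
        rw [← mul_assoc, inv_mul_cancel₀ hc, one_mul]
      · simp only [Module.algebraMap_end_apply, Algebra.smul_def]
        rw [← mul_assoc, mul_inv_cancel₀ hc, one_mul]
    · obtain ⟨j, a, ha⟩ := ThetaTransport.ProfiniteExhaustion.exists_pow_mul_eq_algebraMap_padicCoeffIntegers S y
      refine ⟨(a, ⟨((p : ℕ) : v.adicCompletionIntegers K) ^ j, pow_mem (mem_nonZeroDivisors_of_ne_zero hp0) j⟩), ?_⟩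
      change (((p : ℕ) : v.adicCompletionIntegers K) ^ j) • y = f a
      rw [hf, ha, Algebra.smul_def, map_pow, map_natCast]
  -- the induced `K_v`-basis of `F_S`
  let B := b.ofIsLocalizedModule (v.adicCompletion K) (v.adicCompletionIntegers K)⁰ f
  have hBrepr : ∀ (y : padicCoeffIntegers S) (i : Fin d),
      B.repr (algebraMap (padicCoeffIntegers S) (padicCoeffField S) y) i =
        algebraMap (v.adicCompletionIntegers K) (v.adicCompletion K) (b.repr y i) := fun y i ↦ by
    rw [← hf]; exact b.ofIsLocalizedModule_repr_apply (v.adicCompletion K) (v.adicCompletionIntegers K)⁰ f y i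
  have hBapply : ∀ i : Fin d, B i = algebraMap (padicCoeffIntegers S) (padicCoeffField S) (b i) := fun i ↦ by
    rw [← hf]; exact b.ofIsLocalizedModule_apply (v.adicCompletion K) (v.adicCompletionIntegers K)⁰ f i
  -- integral coordinates ⇒ integral element
  have hint : ∀ x : padicCoeffField S,
      (∀ i : Fin d, ∃ a : v.adicCompletionIntegers K, B.repr x i = algebraMap (v.adicCompletionIntegers K) (v.adicCompletion K) a) →
      ∃ y : padicCoeffIntegers S, algebraMap (padicCoeffIntegers S) (padicCoeffField S) y = x := by
    intro x hx
    choose a ha using hx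
    refine ⟨∑ i, a i • b i, ?_⟩
    rw [← B.sum_repr x, map_sum]
    refine Finset.sum_congr rfl fun i _ ↦ ?_
    rw [ha i, algebraMap_smul, hBapply, ← hf, ← hf, ← LinearMap.map_smul]
  -- the coordinate maps on `Fin 1 → F_S`
  let cvec : Fin d → ((Fin 1 → padicCoeffField S) →+
      (v.adicCompletion K ⧸ Submodule.span (v.adicCompletionIntegers K) {(1 : v.adicCompletion K)})) := fun i ↦
    (((Submodule.span (v.adicCompletionIntegers K) {(1 : v.adicCompletion K)}).mkQ.toAddMonoidHom.comp
      (B.coord i).toAddMonoidHom).comp (Pi.evalAddMonoidHom (fun _ : Fin 1 ↦ padicCoeffField S) 0))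
  have hcvec : ∀ (i : Fin d) (x : Fin 1 → padicCoeffField S), cvec i x = Submodule.Quotient.mk (B.repr (x 0) i) := fun _ _ ↦ rfl
  -- they kill the lattice `𝒪_S`
  have hkill : ∀ i : Fin d, (lattice 1 (padicCoeffIntegers S) (padicCoeffField S)).toAddSubgroup ≤ (cvec i).ker := by
    intro i y hy
    obtain ⟨z, rfl⟩ := (mem_lattice_iff _).1 hy
    rw [AddMonoidHom.mem_ker, hcvec, Submodule.Quotient.mk_eq_zero, Submodule.mem_span_singleton]
    exact ⟨b.repr (z 0) i, by rw [Algebra.smul_def, mul_one, hBrepr]⟩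
  -- the coordinates on `M`
  let c : Fin d → (Cofree θ (padicCoeffField S) →+
      (v.adicCompletion K ⧸ Submodule.span (v.adicCompletionIntegers K) {(1 : v.adicCompletion K)})) := fun i ↦
    QuotientAddGroup.lift (lattice 1 (padicCoeffIntegers S) (padicCoeffField S)).toAddSubgroup (cvec i) (hkill i)
  have hc : ∀ (i : Fin d) (x : Fin 1 → padicCoeffField S),
      c i (cofreeMk (padicCoeffField S) θ x) = Submodule.Quotient.mk (B.repr (x 0) i) := fun i x ↦ by
    rw [← hcvec]; rfl
  -- the non-unit Smith coefficients
  let J : Finset (Fin d) := Finset.univ.filter fun i ↦ ¬ IsUnit (a i)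
  have hJ : ∀ i, i ∈ J ↔ ¬ IsUnit (a i) := fun i ↦ by simp [J]
  -- joint injectivity (all indices)
  have hinj : ∀ m : Cofree θ (padicCoeffField S), (∀ i, c i m = 0) → m = 0 := by
    intro m hm
    obtain ⟨x, rfl⟩ := cofreeMk_surjective (padicCoeffField S) θ m
    have hx : ∀ i : Fin d, ∃ a : v.adicCompletionIntegers K,
        B.repr (x 0) i = algebraMap (v.adicCompletionIntegers K) (v.adicCompletion K) a := fun i ↦ by
      have h := hm i
      rw [hc, Submodule.Quotient.mk_eq_zero, Submodule.mem_span_singleton] at h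
      obtain ⟨a, ha⟩ := h
      exact ⟨a, by rw [← ha, Algebra.smul_def, mul_one]⟩
    obtain ⟨y, hy⟩ := hint (x 0) hx
    rw [← LinearMap.mem_ker, ker_cofreeMk, mem_lattice_iff]
    refine ⟨fun _ ↦ y, funext fun j ↦ ?_⟩
    rw [Subsingleton.elim j 0, hy]
  refine ⟨d, c, J, fun i a' m ↦ ?_, hinj, fun m hπm hmJ ↦ ?_, ?_⟩
  · -- `𝒪_v`-linearity
    obtain ⟨x, rfl⟩ := cofreeMk_surjective (padicCoeffField S) θ m
    have hsm : ι a' • x 0 = (algebraMap (v.adicCompletionIntegers K) (v.adicCompletion K) a') • x 0 := by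
      rw [Algebra.smul_def, Algebra.smul_def, ← IsScalarTower.algebraMap_apply]
      rfl
    rw [← LinearMap.map_smul, hc, hc, Pi.smul_apply, hsm, LinearEquiv.map_smul, Finsupp.smul_apply, ← Submodule.Quotient.mk_smul,
      smul_eq_mul, Algebra.smul_def]
  · -- joint injectivity on the `π`-torsion using only `J`
    refine hinj m fun i ↦ ?_
    by_cases hiJ : i ∈ J
    · exact hmJ i hiJ
    rw [hJ, not_not] at hiJ
    -- `m = [x]` with `π x ∈ 𝒪_S`: `π • x 0 = z`
    obtain ⟨x, rfl⟩ := cofreeMk_surjective (padicCoeffField S) θ m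
    have h0 : cofreeMk (padicCoeffField S) θ (π • x) = 0 := (LinearMap.map_smul (cofreeMk (padicCoeffField S) θ) π x).trans hπm
    rw [← LinearMap.mem_ker, ker_cofreeMk, mem_lattice_iff] at h0
    obtain ⟨z, hz⟩ := h0
    have hz0 : algebraMap (padicCoeffIntegers S) (padicCoeffField S) (z 0) = algebraMap (padicCoeffIntegers S) (padicCoeffField S) π * x 0 := by
      have h := congrFun hz 0
      rw [Pi.smul_apply, Algebra.smul_def] at h
      exact h
    -- the `y`-coordinates of `x 0` are `rb.repr (z 0) i / a i`
    have ha0 : ∀ k : Fin d, algebraMap (v.adicCompletionIntegers K) (v.adicCompletion K) (a k) ≠ 0 := fun k h0 ↦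
      hane k ((IsFractionRing.injective (v.adicCompletionIntegers K) (v.adicCompletion K)) (by rw [h0, map_zero]))
    set w : Fin d → v.adicCompletion K := fun k ↦
      algebraMap (v.adicCompletionIntegers K) (v.adicCompletion K) (rb.repr (z 0) k) /
        algebraMap (v.adicCompletionIntegers K) (v.adicCompletion K) (a k) with hw
    have hπL : algebraMap (padicCoeffIntegers S) (padicCoeffField S) π ≠ 0 := fun h0 ↦ hπ0 (hinjOL (by rw [h0, map_zero]))
    have hx0 : x 0 = ∑ k, w k • B k := by
      apply mul_left_cancel₀ hπL
      rw [← hz0, Finset.mul_sum]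
      have hzsum : z 0 = ∑ k, rb.repr (z 0) k • rb k := (rb.sum_repr (z 0)).symm
      conv_lhs => rw [hzsum, map_sum]
      refine Finset.sum_congr rfl fun k _ ↦ ?_
      -- `algebraMap (r • rb k) = r • algebraMap (rb k)` and `π * B k = a k • algebraMap (rb k)`
      have h1 : algebraMap (padicCoeffIntegers S) (padicCoeffField S) (rb.repr (z 0) k • rb k) =
          (algebraMap (v.adicCompletionIntegers K) (v.adicCompletion K) (rb.repr (z 0) k)) •
            algebraMap (padicCoeffIntegers S) (padicCoeffField S) (rb k) := by
        rw [← hf, LinearMap.map_smul, algebraMap_smul, hf]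
      have h2 : algebraMap (padicCoeffIntegers S) (padicCoeffField S) π * B k =
          (algebraMap (v.adicCompletionIntegers K) (v.adicCompletion K) (a k)) •
            algebraMap (padicCoeffIntegers S) (padicCoeffField S) (rb k) := by
        rw [hBapply, ← map_mul, hb k, ← hf, LinearMap.map_smul, algebraMap_smul, hf]
      rw [h1, mul_smul_comm, h2, smul_smul, hw]
      congr 1
      rw [div_mul_cancel₀ _ (ha0 k)]
    have hrepr : B.repr (x 0) i = w i := by
      rw [hx0, B.repr_sum_self]
    -- `a i` a unit ⇒ the coordinate is integral ⇒ `c i m = 0`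
    obtain ⟨ua, hua⟩ := hiJ
    rw [hc, hrepr, Submodule.Quotient.mk_eq_zero, Submodule.mem_span_singleton]
    refine ⟨rb.repr (z 0) i * ↑ua⁻¹, ?_⟩
    rw [Algebra.smul_def, mul_one, hw]
    simp only
    rw [← hua, eq_div_iff (by rw [hua]; exact ha0 i), map_mul, mul_assoc, ← map_mul, Units.inv_mul, map_one, mul_one]
  · -- the count `p ^ (2 #J) = #(𝒪_S ⧸ (π))`
    have hmax := maximalIdeal_adicCompletionIntegers_eq_span_natCast v hv
    have hirr : Irreducible ((p : ℕ) : v.adicCompletionIntegers K) :=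
      IsDiscreteValuationRing.irreducible_of_span_eq_maximalIdeal _ (fun h ↦ hp0 h) hmax
    -- every Smith coefficient divides `p`: `p` kills `𝒪_S ⧸ (π) ≃ Π 𝒪_v ⧸ (a k)`
    have hdvd : ∀ k : Fin d, a k ∣ ((p : ℕ) : v.adicCompletionIntegers K) := by
      intro k
      have e := Ideal.quotientEquivPiSpan (Ideal.span ({π} : Set (padicCoeffIntegers S))) b₀ hI
      rw [ha] at e
      have hsurj : ∀ q' : v.adicCompletionIntegers K ⧸ Ideal.span ({a k} : Set (v.adicCompletionIntegers K)),
          ∃ t, e t k = q' := fun q' ↦ by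
        obtain ⟨t, ht⟩ := e.surjective (Function.update (fun _ ↦ 0) k q')
        exact ⟨t, by rw [ht, Function.update_self]⟩
      obtain ⟨t, ht⟩ := hsurj (Ideal.Quotient.mk _ 1)
      obtain ⟨s', rfl⟩ := Ideal.Quotient.mk_surjective t
      have hpt : ((p : ℕ) : v.adicCompletionIntegers K) •
          (Ideal.Quotient.mk (Ideal.span ({π} : Set (padicCoeffIntegers S))) s') = 0 := by
        rw [← Ideal.Quotient.mk_eq_mk, ← Submodule.Quotient.mk_smul, Ideal.Quotient.mk_eq_mk, Ideal.Quotient.eq_zero_iff_mem,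
          Algebra.smul_def, map_natCast]
        exact Ideal.mul_mem_right _ _ hpI
      have h1 : ((p : ℕ) : v.adicCompletionIntegers K) •
          (Ideal.Quotient.mk (Ideal.span ({a k} : Set (v.adicCompletionIntegers K))) 1) = 0 := by
        rw [← ht, ← Pi.smul_apply, ← map_smul, hpt, map_zero, Pi.zero_apply]
      rw [← Ideal.Quotient.mk_eq_mk, ← Submodule.Quotient.mk_smul, Ideal.Quotient.mk_eq_mk, smul_eq_mul, mul_one,
        Ideal.Quotient.eq_zero_iff_mem, Ideal.mem_span_singleton] at h1
      exact h1
    -- non-unit coefficients generate `𝔪 = (p)`; unit ones give trivial quotients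
    have hspan : ∀ k ∈ J, Ideal.span ({a k} : Set (v.adicCompletionIntegers K)) = IsLocalRing.maximalIdeal (v.adicCompletionIntegers K) := by
      intro k hk
      rw [hJ] at hk
      obtain ⟨t, ht⟩ := hdvd k
      have htu : IsUnit t := by
        rcases hirr.isUnit_or_isUnit ht with h | h
        · exact absurd h hk
        · exact h
      rw [hmax]
      exact Ideal.span_singleton_eq_span_singleton.mpr ⟨htu.unit, by rw [IsUnit.unit_spec]; exact ht.symm⟩
    have htop : ∀ k, k ∉ J → Ideal.span ({a k} : Set (v.adicCompletionIntegers K)) = ⊤ := by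
      intro k hk
      rw [hJ, not_not] at hk
      exact Ideal.span_singleton_eq_top.mpr hk
    -- count through `𝒪_S ⧸ (π) ≃ Π 𝒪_v ⧸ (a k)`
    have e := Ideal.quotientEquivPiSpan (Ideal.span ({π} : Set (padicCoeffIntegers S))) b₀ hI
    rw [ha] at e
    rw [Nat.card_congr e.toEquiv, Nat.card_pi]
    have hq : p ^ 2 = Nat.card (IsLocalRing.ResidueField (v.adicCompletionIntegers K)) :=
      (natCard_residueField_adicCompletionIntegers_eq_sq v hK2 hv).symm
    rw [pow_mul, hq, ← Finset.prod_const, ← Finset.prod_filter_mul_prod_filter_not Finset.univ (fun i ↦ ¬ IsUnit (a i))]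
    have h1 : ∏ k ∈ Finset.univ.filter (fun i : Fin d ↦ ¬¬IsUnit (a i)), Nat.card (v.adicCompletionIntegers K ⧸ Ideal.span {a k}) = 1 := by
      refine Finset.prod_eq_one fun k hk ↦ ?_
      have hk' : k ∉ J := by rw [hJ]; simpa using hk
      rw [htop k hk']
      haveI : Subsingleton (v.adicCompletionIntegers K ⧸ (⊤ : Ideal (v.adicCompletionIntegers K))) := Ideal.Quotient.subsingleton_iff.mpr rfl
      exact Nat.card_of_subsingleton (0 : v.adicCompletionIntegers K ⧸ (⊤ : Ideal (v.adicCompletionIntegers K)))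
    rw [h1, mul_one]
    refine Finset.prod_congr rfl fun k hk ↦ ?_
    rw [hspan k hk]
    rfl

end Adapted

end Summit.BirchSwinnertonDyer.BirchSwinnertonDyer.Theorems.SmallImageRttCharRoad

end
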